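import Literature.AnabelianGeometry.AbsoluteAnabelian.AbsTopII.DehnTwistExtension
import Literature.AnabelianGeometry.AbsoluteAnabelian.AbsTopII.DPSCIndexDataOfEmbedding
import Literature.AnabelianGeometry.EtaleTheta.SettingModelCuspAxis
import HarnessLib

/-!
# [AbsTopII] Def 1.2 (ii) WITH A NODE, stage S2: the loop-graph PSC datum on `F̂₂` and its DPSC data

S. Mochizuki, *Topics in Absolute Anabelian Geometry II* [AbsTopII] (bib `MochizukiAbsTopII2013`; locators =
PDF pages of the kurims manuscript `paper:url-585b8d0ad0d9`), §1, Example 1.1 (ii)/(iii) p. 9, Def 1.2 (ii)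
p. 10; S. Mochizuki, *A combinatorial version of the Grothendieck conjecture* [CombGC]
(`MochizukiCombGC2007`) Def 1.1 (ii) pp. 6–7 (verticial / nodal / cuspidal subgroups of a semi-graph of
anabelioids of PSC-type).

MODEL/CONSTRUCTION file (class (b): two defs, no instance), abc-iut-L4-t6 lineage, row «DPSC-NODAL-MODEL»
stage S2 (design memo HOME/staging/L4/abc-iut-L4-t6/gen7/MEMO-DPSC-NODAL-MODEL.md; S1 = `DehnTwistExtension.lean`).
The dual semi-graph of the DEGENERATING once-punctured curve of genus one — ONE vertex `v` (normalisation
`ℙ¹ ∖ {0,1,∞}`, genus `0`), ONE LOOP node `e` (both branches at `v`), ONE cusp `c` — carried by `Π_𝒢 := F̂₂ =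
⟨a, b⟩^` (`a = η(x₀)` the stable letter, `b = η(x₁)` the vanishing cycle), with representatives
`Π_v := ⟨b^Ẑ, a b^Ẑ a⁻¹⟩^` (the closure of the subgroup generated by the two branches), `Π_e := b^Ẑ` (L2's `bAxis`),
`Π_c := ⟨a b a⁻¹ b⁻¹⟩^` (the commutator — the cusp of the once-punctured torus), `Σ := 𝔓𝔯𝔦𝔪𝔢𝔰`:

* `DehnTwist.loopDatum : PSCDatum F₂hatT` — layer L3's interface [CombGC] Def 1.1 (ii) instantiated (branch
  inclusions with the conjugating elements `1`; `Π_c ≤ Π_v` since `[a,b] = (aba⁻¹)·b⁻¹`);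
* `DehnTwist.dpsc i hi : DPSCIndexData` — abc-iut-f-069's `DPSCIndexData.ofEmbedding` of `loopDatum` into the
  Dehn-twist extension `Π_I = F̂₂ ⋊_{shear^i} Ẑ` of S1 (`Π_H = Π_I`, i.e. `H = I = Ẑ`), with the node's
  `Σ`-index `i^Σ_e := i` (Ex 1.1 (iii); `i ≥ 1`).
Facts for S3 proved here: `inl` has closed normal range (`= Ker (Π_I ↠ Ẑ)`), `Π_c ≤ Π_v`, `Π_e ≤ Π_v`.
HONEST FRAMING: a constructed datum (constructed ≠ geometric: that these closed subgroups ARE the verticial /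
edge-like subgroups of the semi-graph of anabelioids of the degenerate curve is the model's label — Riemann
existence / log specialisation are not in the tree); the [CombGC] Prop 1.2 / Rmk 1.1.3 properties of the datum
are NOT asserted here (hypotheses BY NAME downstream); nothing here bears on [IUTchIII] Cor 3.12.
-/

noncomputable section

open scoped Pointwise

namespace Literature.AnabelianGeometry.AbsoluteAnabelian.AbsTopII.DehnTwist

open Literature.AnabelianGeometry.EtaleTheta.SettingModel
open Literature.AnabelianGeometry.SemiGraphs
open Literature.AnabelianGeometry.Anabelioids (IsSigmaInteger)
open _root_.Topology

/-! ### The three representatives in `F̂₂` -/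

/-- The stable letter `a := η(x₀)`. [cite: MochizukiAbsTopII2013, Ex 1.1 (ii) p.9] -/
abbrev genA : F₂hatT := eta (FreeGroup.of 0)

/-- The vanishing cycle `b := η(x₁)`. [cite: MochizukiAbsTopII2013, Ex 1.1 (ii) p.9] -/
abbrev genB : F₂hatT := eta (FreeGroup.of 1)

/-- `Π_e := b^Ẑ`, the nodal representative: the `b`-axis of layer L2 (`bAxis = range bPow`, closed, `≃ₜ* Ẑ` by
`zHatEquivBAxis`). [cite: MochizukiCombGC2007, Def 1.1(ii) p.7] -/
def nodeGp : Subgroup F₂hatT := bAxis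

/-- `Π_v := ⟨b^Ẑ, a·b^Ẑ·a⁻¹⟩^`, the verticial representative: the closure of the subgroup generated by the two
branch images of the node group at `v`. [cite: MochizukiCombGC2007, Def 1.1(ii) p.6] -/
def vertGp : Subgroup F₂hatT := (bAxis ⊔ MulAut.conj genA • bAxis).topologicalClosure

/-- `Π_c := ⟨[a,b]⟩^ = ⟨a b a⁻¹ b⁻¹⟩^`, the cuspidal representative. [cite: MochizukiCombGC2007, Def 1.1(ii) p.7] -/
def cuspGp : Subgroup F₂hatT := (Subgroup.zpowers (genA * genB * genA⁻¹ * genB⁻¹)).topologicalClosure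

/-- First branch: `Π_e ≤ Π_v`. [cite: MochizukiCombGC2007, Def 1.1(ii) p.6] -/
theorem nodeGp_le_vertGp : nodeGp ≤ vertGp :=
  le_trans le_sup_left (Subgroup.le_topologicalClosure _)

/-- Second branch: `a · Π_e · a⁻¹ ≤ Π_v`. [cite: MochizukiCombGC2007, Def 1.1(ii) p.6] -/
theorem conj_nodeGp_le_vertGp : MulAut.conj genA • nodeGp ≤ vertGp :=
  le_trans le_sup_right (Subgroup.le_topologicalClosure _)

/-- The cusp branch: `Π_c ≤ Π_v` (`[a,b] = (a b a⁻¹) · b⁻¹`, `b ∈ b^Ẑ`). [cite: MochizukiCombGC2007, Def 1.1(ii) p.7] -/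
theorem cuspGp_le_vertGp : cuspGp ≤ vertGp := by
  refine Subgroup.topologicalClosure_mono ((Subgroup.zpowers_le).mpr ?_)
  have hb : genB ∈ (bAxis ⊔ MulAut.conj genA • bAxis : Subgroup F₂hatT) :=
    Subgroup.mem_sup_left eta_of_one_mem_bAxis
  have hab : genA * genB * genA⁻¹ ∈ (bAxis ⊔ MulAut.conj genA • bAxis : Subgroup F₂hatT) := by
    refine Subgroup.mem_sup_right ?_
    rw [Subgroup.mem_smul_pointwise_iff_exists]
    exact ⟨genB, eta_of_one_mem_bAxis, (MulAut.conj_apply _ _).symm⟩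
  exact Subgroup.mul_mem _ hab (Subgroup.inv_mem _ hb)

/-! ### The loop graph and the PSC datum -/

/-- The dual semi-graph of the degenerating once-punctured genus-one curve: one vertex, one LOOP node (both
branches at the vertex), one cusp. [cite: MochizukiAbsTopII2013, Ex 1.1 (ii) p.9] -/
def loopGraph : PSCSemiGraph where
  V := Unit
  N := Unit
  C := Unit
  nodeEnds _ := s((), ())
  cuspEnd _ := ()

/-- **The loop-graph PSC datum on `F̂₂`** ([CombGC] Def 1.1 (ii) interface of layer L3): `Σ = 𝔓𝔯𝔦𝔪𝔢𝔰`,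
representatives `Π_v = ⟨b^Ẑ, ab^Ẑa⁻¹⟩^`, `Π_e = b^Ẑ`, `Π_c = ⟨[a,b]⟩^`, genus `0`, branch inclusions with the
conjugating elements `1` (the second branch of the loop, `aΠ_ea⁻¹ ≤ Π_v`, is `conj_nodeGp_le_vertGp`).
Honest label: a constructed datum; [CombGC] Rmk 1.1.3 / Prop 1.2 for it are NOT asserted here.
[cite: MochizukiCombGC2007, Def 1.1(ii) pp.6-7] -/
def loopDatum : PSCDatum F₂hatT where
  Sigma := {p | p.Prime}
  sigma_prime _ hp := hp
  sigma_nonempty := ⟨2, Nat.prime_two⟩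
  graph := loopGraph
  vertGp _ := vertGp
  nodeGp _ := nodeGp
  cuspGp _ := cuspGp
  genus _ := 0
  isClosed_vertGp _ := Subgroup.isClosed_topologicalClosure _
  isClosed_nodeGp _ := isClosed_bAxis
  isClosed_cuspGp _ := Subgroup.isClosed_topologicalClosure _
  nodeGp_le _ := ⟨(), (), rfl, ⟨1, by rw [one_smul]; exact nodeGp_le_vertGp⟩,
    ⟨1, by rw [one_smul]; exact nodeGp_le_vertGp⟩⟩
  cuspGp_le _ := ⟨1, by rw [one_smul]; exact cuspGp_le_vertGp⟩
  proSigma := ⟨fun _ _ _ hp _ => hp⟩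

/-! ### The DPSC data: `loopDatum` embedded in the Dehn-twist extension -/

variable (i : ℕ)

/-- `Π_𝔾 := inl(F̂₂) = Ker (Π_I ↠ Ẑ)` is closed in `Π_I`. [cite: MochizukiAbsTopII2013, Def 1.2 (ii) p.10] -/
theorem isClosed_range_inl :
    IsClosed ((SemidirectProduct.inl : F₂hatT →* Ext i).range : Set (Ext i)) := by
  rw [SemidirectProduct.range_inl_eq_ker_rightHom]
  change IsClosed ((proj i).toMonoidHom.ker : Set (Ext i))
  rw [MonoidHom.coe_ker]
  exact isClosed_singleton.preimage (proj i).continuous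

/-- `Π_𝔾 = inl(F̂₂)` is normal in `Π_I`. [cite: MochizukiAbsTopII2013, Def 1.2 (ii) p.10] -/
theorem normal_range_inl : ((SemidirectProduct.inl : F₂hatT →* Ext i).range).Normal := by
  rw [SemidirectProduct.range_inl_eq_ker_rightHom]
  infer_instance

/-- **The DPSC-index data of the degenerate once-punctured genus-one curve over the log point with inertia
`Ẑ` acting by the Dehn twist of speed `i`** (`i ≥ 1` = the `Σ`-index `i^Σ_e` of the node, Ex 1.1 (iii)):
`Π_H = Π_I = F̂₂ ⋊_{shear^i} Ẑ`, `Π_𝔾 = F̂₂ × 1`, one vertex / one loop node / one cusp with the representatives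
of `loopDatum` (abc-iut-f-069's `DPSCIndexData.ofEmbedding`).  The FIRST DPSC datum WITH A NODE in the tree.
[cite: MochizukiAbsTopII2013, Def 1.2 (ii) p.10] -/
def dpsc (hi : 0 < i) : DPSCIndexData.{0} :=
  DPSCIndexData.ofEmbedding loopDatum (extGrp i) (SemidirectProduct.inl : F₂hatT →* Ext i)
    (isClosed_range_inl i) (normal_range_inl i) ⊤ inferInstance le_top (fun _ => i)
    (fun _ => ⟨hi, fun _ hp _ => hp⟩)

/-- The DPSC data of `dpsc` is the embedded loop datum (`rfl`). [cite: MochizukiAbsTopII2013, Def 1.2 (ii) p.10] -/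
theorem dpsc_toDPSCData (hi : 0 < i) :
    (dpsc i hi).toDPSCData = DPSCData.ofEmbedding loopDatum (extGrp i)
      (SemidirectProduct.inl : F₂hatT →* Ext i) (isClosed_range_inl i) (normal_range_inl i) ⊤
      inferInstance le_top := rfl

/-- The node of `dpsc` has `Σ`-index `i`. [cite: MochizukiAbsTopII2013, Ex 1.1 (iii) p.9] -/
theorem dpsc_sigmaIndex (hi : 0 < i) (e : (dpsc i hi).Node) : (dpsc i hi).sigmaIndex e = i := rfl

/-- `dpsc` has exactly one node and one cusp and one vertex (all index types are `Unit`).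
[cite: MochizukiAbsTopII2013, Ex 1.1 (ii) p.9] -/
theorem dpsc_node_nonempty (hi : 0 < i) : Nonempty (dpsc i hi).Node := ⟨⟨()⟩⟩

end Literature.AnabelianGeometry.AbsoluteAnabelian.AbsTopII.DehnTwist

end
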